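import Mathlib
import HarnessLib

/-!
# `𝔰𝔩(n, K)` is a SIMPLE Lie algebra for `|n| ≥ 2` in characteristic `0` [Humphreys1972, §2 Ex. 6, §19.2]

statement-level skeleton of published theorems with citation tags; proofs where landed; nothing here is a claim about
the Yang–Mills mass gap (cell `lit-balaban` page-1 framing sentence — this is a classical support file of that cell, unit
`lit-balaban-p24`; sentence added in a docstring-only revision, referee N1 census gen 70; declarations byte-identical).

Topic `Algebra/Lie`.  For a field `K` in which `2 ≠ 0` and `|n| ≠ 0` (in particular in characteristic zero) and a
finite index type `n` with at least two elements, Mathlib's special linear Lie algebra `LieAlgebra.SpecialLinear.sl n K`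
(traceless matrices, commutator bracket) is SIMPLE in Mathlib's sense `LieAlgebra.IsSimple` (every Lie ideal is `⊥` or
`⊤`, and the algebra is not abelian): `isSimple_sl`, and the instance `instIsSimpleSl` under
`[CharZero K] [Fact (1 < Fintype.card n)]`.

The proof is the classical matrix-unit argument (Humphreys §2 Exercise 6 for `𝔰𝔩(3, F)` «use the standard basis
h₁, h₂, e_{ij}», which is general; §19.2: the algebras `A_l` are simple).  Let `I` be an ideal containing a non-zero
(traceless) `X`; write `E_{ij}` for the matrix units and `H_{ij} = E_{ii} − E_{jj}`.
* If some off-diagonal entry `X_{ji} ≠ 0` (`i ≠ j`): `[E_{ij}, [E_{ij}, X]] = −2X_{ji}E_{ij} ∈ I` (`ad_single_sq`), so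
  `E_{ij} ∈ I`.
* Otherwise `X` is diagonal, traceless, non-zero, hence not scalar (this uses `|n| ≠ 0`): `X_{ii} ≠ X_{jj}` for some
  `i ≠ j`, and `[E_{ij}, X] = (X_{jj} − X_{ii})E_{ij} ∈ I` (`single_comm_of_offDiag_eq_zero`), so `E_{ij} ∈ I`.
* From one unit all of them: `[E_{ki}, E_{ij}] = E_{kj}`, `[E_{jl}, E_{ij}] = −E_{il}`, `[E_{ji}, E_{ij}] = −H_{ij}`,
  `[E_{ji}, H_{ij}] = 2E_{ji}`; and the `E_{kl}` (`k ≠ l`) together with the `H_{kk₀}` span `𝔰𝔩_n`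
  (`eq_sum_units_of_trace_eq_zero`), so `I = ⊤`.
Non-abelian: Mathlib `LieAlgebra.SpecialLinear.sl_non_abelian`.  The whole argument is run on the IMAGE of the ideal in
`Matrix n n K` (a `K`-submodule stable under `Y·m − m·Y` for traceless `Y`), so no coercion bookkeeping is needed.

Mathlib (this pin) has `sl`, `sl_non_abelian`, `LieAlgebra.IsSimple`, but not the simplicity of `sl n K` (searched:
`IsSimple` lemmas — only the abstract `isSimple_of_isAtom` and `IsKilling.isSimple_iff_isIrreducible` via root systems).
The commutator Lie ring structure on `Matrix n n K` is Mathlib's LOCAL instance `LieRing.ofAssociativeRing` (as in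
`Mathlib.Algebra.Lie.Classical`), enabled for this file.  Companions: `Literature.Algebra.Lie.SpecialLinearKilling`
(Killing form `2|n|·Tr(XY)`, semisimplicity), `Literature.Algebra.Lie.CompactKillingForm` (`𝔰𝔲(n)`).  Consumer: the
Bałaban cell's Schur step `…Balaban1983to89.B12Schur433` (`[LieAlgebra.IsSimple _ 𝔤]`; print's example `G = SU(N)`,
`𝔤ᶜ = 𝔰𝔩(N, ℂ)`).

## References

* [Humphreys1972] J. E. Humphreys, *Introduction to Lie Algebras and Representation Theory*, GTM 9 (1972): §2 Exercise 6
  («Prove that 𝔰𝔩(3, F) is simple, unless char F = 3 … [Use the standard basis h₁, h₂, e_{ij} (i ≠ j). …]»), §2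
  Exercise 3 (centre of `𝔰𝔩(n, F)` is `0` unless `char F ∣ n`), §19.2 «The classical algebras» (semisimple, and «simple of the type indicated»).
* [Hall2015] B. C. Hall, *Lie Groups, Lie Algebras, and Representations*, 2nd ed., GTM 222 (2015), §7.1 Example 7.3
  (the matrix-unit computation in `𝔰𝔩(n; ℂ)`), §7.7.1 (`𝔰𝔩(n; ℂ)`).
-/

-- Mathlib idiom (`Mathlib.Algebra.Lie.Classical`): the commutator bracket on an associative ring is the NON-instance
-- `LieRing.ofAssociativeRing`, enabled file-locally exactly as where `LieAlgebra.SpecialLinear.sl` is defined.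
attribute [local instance 100] LieRing.ofAssociativeRing

namespace Literature.Algebra.Lie.SpecialLinearSimple

open LieAlgebra LieAlgebra.SpecialLinear Matrix

variable {n : Type*} [Fintype n] [DecidableEq n] {K : Type*} [Field K]

/-! ### Matrix-unit identities (`E_{ij} = single i j 1`, `H_{ij} = E_{ii} − E_{jj}`) -/

/-- `E_{ij}(E_{ij}X − XE_{ij}) − (E_{ij}X − XE_{ij})E_{ij} = −2X_{ji}E_{ij}` (`i ≠ j`): the square of `ad E_{ij}` on `X`.
[cite: Humphreys1972, §2 Exercise 6] -/
theorem ad_single_sq {i j : n} (hij : i ≠ j) (X : Matrix n n K) :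
    single i j (1 : K) * (single i j 1 * X - X * single i j 1) - (single i j 1 * X - X * single i j 1) * single i j 1 =
      (-(2 * X j i)) • single i j (1 : K) := by
  have h0 : single i j (1 : K) * single i j (1 : K) = 0 := single_mul_single_of_ne (1 : K) i j i hij.symm 1
  have h1 : single i j (1 : K) * X * single i j (1 : K) = X j i • single i j (1 : K) := by
    rw [single_mul_mul_single, smul_single, smul_eq_mul, mul_one, one_mul, mul_one]
  rw [Matrix.mul_sub, Matrix.sub_mul, ← Matrix.mul_assoc, h0, Matrix.zero_mul, Matrix.mul_assoc X, h0,
    Matrix.mul_zero, sub_zero, zero_sub, ← Matrix.mul_assoc, h1, neg_smul, mul_smul, two_smul, neg_add]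
  abel

/-- For a DIAGONAL `X`: `E_{ij}X − XE_{ij} = (X_{jj} − X_{ii})E_{ij}`. [cite: Hall2015, Example 7.3] -/
theorem single_comm_of_offDiag_eq_zero {i j : n} (X : Matrix n n K) (hX : ∀ a b, a ≠ b → X a b = 0) :
    single i j (1 : K) * X - X * single i j 1 = (X j j - X i i) • single i j (1 : K) := by
  have hdiag : X = diagonal fun a => X a a := by
    ext a b
    by_cases hab : a = b
    · subst hab; rw [diagonal_apply_eq]
    · rw [diagonal_apply_ne _ hab, hX a b hab]
  rw [hdiag]
  ext a b
  simp only [mul_diagonal, diagonal_mul, Matrix.sub_apply, Matrix.smul_apply, single_apply, smul_eq_mul]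
  by_cases h : i = a ∧ j = b
  · obtain ⟨rfl, rfl⟩ := h
    simp
  · simp [h]

/-- `E_{ki}E_{ij} − E_{ij}E_{ki} = E_{kj}` for `j ≠ k`. [cite: Humphreys1972, §2 Exercise 6] -/
theorem single_comm_single_left {k i j : n} (hjk : j ≠ k) :
    single k i (1 : K) * single i j 1 - single i j 1 * single k i 1 = single k j 1 := by
  rw [single_mul_single_same, mul_one, single_mul_single_of_ne (1 : K) i j k hjk 1, sub_zero]

/-- `E_{jl}E_{ij} − E_{ij}E_{jl} = −E_{il}` for `l ≠ i`. [cite: Humphreys1972, §2 Exercise 6] -/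
theorem single_comm_single_right {i j l : n} (hli : l ≠ i) :
    single j l (1 : K) * single i j 1 - single i j 1 * single j l 1 = -single i l 1 := by
  rw [single_mul_single_of_ne (1 : K) j l i hli 1, single_mul_single_same, mul_one, zero_sub]

/-- `E_{ji}E_{ij} − E_{ij}E_{ji} = −H_{ij} = E_{jj} − E_{ii}`. [cite: Humphreys1972, §2 Exercise 6] -/
theorem single_comm_single_transpose (i j : n) :
    single j i (1 : K) * single i j 1 - single i j 1 * single j i 1 = single j j 1 - single i i 1 := by
  rw [single_mul_single_same, single_mul_single_same, mul_one]

/-- `E_{ji}(E_{jj} − E_{ii}) − (E_{jj} − E_{ii})E_{ji} = −2E_{ji}` for `i ≠ j`. [cite: Humphreys1972, §2 Exercise 6] -/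
theorem single_comm_diag {i j : n} (hij : i ≠ j) :
    single j i (1 : K) * (single j j 1 - single i i 1) - (single j j 1 - single i i 1) * single j i 1 =
      (-2 : K) • single j i (1 : K) := by
  rw [Matrix.mul_sub, Matrix.sub_mul, single_mul_single_of_ne (1 : K) j i j hij 1, single_mul_single_same,
    single_mul_single_same, single_mul_single_of_ne (1 : K) i i j hij 1, mul_one, zero_sub, sub_zero, neg_smul,
    two_smul, neg_add]
  abel

/-- Every traceless matrix is a combination of the `E_{kl}` (`k ≠ l`) and the `H_{kk₀} = E_{kk} − E_{k₀k₀}`: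
`X = Σ_{a,b} X_{ab}·m_{ab}` with `m_{ab} = E_{ab}` (`a ≠ b`), `m_{aa} = H_{ak₀}`. [cite: Humphreys1972, §1.2] -/
theorem eq_sum_units_of_trace_eq_zero (k₀ : n) {X : Matrix n n K} (hX : X.trace = 0) :
    X = ∑ a, ∑ b, X a b • (if a = b then single a a (1 : K) - single k₀ k₀ 1 else single a b 1) := by
  have hsplit : ∀ a b, X a b • (if a = b then single a a (1 : K) - single k₀ k₀ 1 else single a b 1) =
      X a b • single a b 1 - (if a = b then X a b else 0) • single k₀ k₀ (1 : K) := by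
    intro a b
    split_ifs with h
    · subst h; rw [smul_sub]
    · rw [zero_smul, sub_zero]
  simp_rw [hsplit, Finset.sum_sub_distrib, ← Finset.sum_smul]
  have hdiag : ∑ a, ∑ b, (if a = b then X a b else 0) = X.trace := by
    simp [Matrix.trace]
  rw [hdiag, hX, zero_smul, sub_zero]
  simp_rw [smul_single, smul_eq_mul, mul_one]
  exact matrix_eq_sum_single X

/-! ### Simplicity -/

/-- **Every Lie ideal of `𝔰𝔩(n, K)` is `⊥` or `⊤`** when `2 ≠ 0` and `|n| ≠ 0` in `K`.
[cite: Humphreys1972, §2 Exercise 6, §19.2] -/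
theorem eq_bot_or_eq_top_of_lieIdeal (h2 : (2 : K) ≠ 0) (hn : (Fintype.card n : K) ≠ 0)
    (I : LieIdeal K (sl n K)) : I = ⊥ ∨ I = ⊤ := by
  classical
  -- the image `J` of `I` in the matrices, a `K`-submodule stable under `Y·m − m·Y` for traceless `Y`
  set J : Submodule K (Matrix n n K) := (I : Submodule K (sl n K)).map (sl n K).toSubmodule.subtype with hJ
  have hJmem : ∀ {m : Matrix n n K}, m ∈ J ↔ ∃ hm : m ∈ sl n K, (⟨m, hm⟩ : sl n K) ∈ I := by
    intro m
    rw [hJ, Submodule.mem_map]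
    constructor
    · rintro ⟨y, hy, rfl⟩
      exact ⟨y.2, hy⟩
    · rintro ⟨hm, hmI⟩
      exact ⟨⟨m, hm⟩, hmI, rfl⟩
  have hJlie : ∀ {m : Matrix n n K} (Y : Matrix n n K), Y.trace = 0 → m ∈ J → Y * m - m * Y ∈ J := by
    intro m Y hY hm
    obtain ⟨hm, hmI⟩ := hJmem.1 hm
    have h := I.lie_mem (x := (⟨Y, hY⟩ : sl n K)) hmI
    exact hJmem.2 ⟨_, h⟩
  have hJsmul : ∀ {c : K} {m : Matrix n n K}, c ≠ 0 → c • m ∈ J → m ∈ J := fun hc hm =>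
    (J.smul_mem_iff hc).1 hm
  by_cases hbot : ∀ m ∈ I, m = (0 : sl n K)
  · left
    rw [eq_bot_iff]
    intro m hm
    rw [LieSubmodule.mem_bot]
    exact hbot m hm
  right
  push Not at hbot
  obtain ⟨x, hxI, hx0⟩ := hbot
  set X : Matrix n n K := (x : Matrix n n K) with hXdef
  have hXJ : X ∈ J := hJmem.2 ⟨x.2, hxI⟩
  have hXtr : X.trace = 0 := x.2
  have hX0 : X ≠ 0 := fun h => hx0 (Subtype.ext h)
  -- Step 1: some matrix unit `E_{ij}`, `i ≠ j`, lies in `J`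
  obtain ⟨i, j, hij, hE⟩ : ∃ i j : n, i ≠ j ∧ single i j (1 : K) ∈ J := by
    by_cases hoff : ∃ i j : n, i ≠ j ∧ X j i ≠ 0
    · obtain ⟨i, j, hij, hXji⟩ := hoff
      refine ⟨i, j, hij, ?_⟩
      have htrE : (single i j (1 : K)).trace = 0 := trace_single_eq_of_ne i j 1 hij
      have h1 : single i j 1 * X - X * single i j 1 ∈ J := hJlie _ htrE hXJ
      have h2' := hJlie _ htrE h1
      rw [ad_single_sq hij] at h2'
      exact hJsmul (neg_ne_zero.2 (mul_ne_zero h2 hXji)) h2'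
    · push Not at hoff
      have hoff' : ∀ a b, a ≠ b → X a b = 0 := fun a b hab => hoff b a (Ne.symm hab)
      -- `X` is diagonal and non-zero with trace `0`, hence not scalar
      obtain ⟨i, j, hij, hne⟩ : ∃ i j : n, i ≠ j ∧ X i i ≠ X j j := by
        by_contra hall
        push Not at hall
        apply hX0
        obtain ⟨i₀⟩ : Nonempty n := by
          by_contra hne
          rw [not_nonempty_iff] at hne
          exact hX0 (Matrix.ext fun a _ => isEmptyElim a)
        have hconst : ∀ a, X a a = X i₀ i₀ := fun a => by
          by_cases h : a = i₀
          · rw [h]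
          · exact hall a i₀ h
        have htr : X.trace = Fintype.card n * X i₀ i₀ := by
          rw [Matrix.trace]
          simp_rw [Matrix.diag_apply]
          rw [Finset.sum_congr rfl fun a _ => hconst a, Finset.sum_const, Finset.card_univ, nsmul_eq_mul]
        rw [hXtr] at htr
        have hc : X i₀ i₀ = 0 := (mul_eq_zero.1 htr.symm).resolve_left hn
        ext a b
        by_cases hab : a = b
        · subst hab; rw [hconst a, hc]; rfl
        · exact hoff' a b hab
      refine ⟨i, j, hij, ?_⟩
      have h1 : single i j 1 * X - X * single i j 1 ∈ J := hJlie _ (trace_single_eq_of_ne i j 1 hij) hXJ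
      rw [single_comm_of_offDiag_eq_zero X hoff'] at h1
      exact hJsmul (sub_ne_zero.2 (Ne.symm hne)) h1
  -- Step 2: all matrix units `E_{kl}`, `k ≠ l`, lie in `J`
  have hcol : ∀ {k} (_ : k ≠ j), single k j (1 : K) ∈ J := by
    intro k hkj
    by_cases hki : k = i
    · subst hki; exact hE
    · have h := hJlie (single k i (1 : K)) (trace_single_eq_of_ne k i 1 hki) hE
      rwa [single_comm_single_left (Ne.symm hkj)] at h
  have hrow : ∀ {a b} (_ : a ≠ b), single a b (1 : K) ∈ J → ∀ {l} (_ : a ≠ l), single a l (1 : K) ∈ J := by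
    intro a b hab hmem l hal
    by_cases hbl : b = l
    · subst hbl; exact hmem
    · have h := hJlie (single b l (1 : K)) (trace_single_eq_of_ne b l 1 hbl) hmem
      rw [single_comm_single_right (Ne.symm hal)] at h
      simpa using J.neg_mem h
  have hji : single j i (1 : K) ∈ J := by
    have hH : single j j (1 : K) - single i i 1 ∈ J := by
      have h := hJlie (single j i (1 : K)) (trace_single_eq_of_ne j i 1 hij.symm) hE
      rwa [single_comm_single_transpose] at h
    have h := hJlie (single j i (1 : K)) (trace_single_eq_of_ne j i 1 hij.symm) hH
    rw [single_comm_diag hij] at h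
    exact hJsmul (neg_ne_zero.2 h2) h
  have hall : ∀ {k l} (_ : k ≠ l), single k l (1 : K) ∈ J := by
    intro k l hkl
    by_cases hkj : k = j
    · subst hkj; exact hrow hij.symm hji hkl
    · exact hrow hkj (hcol hkj) hkl
  -- the diagonal generators `H_{k k₀} = E_{kk} − E_{k₀k₀}`
  have hdiag : ∀ k k₀ : n, single k k (1 : K) - single k₀ k₀ 1 ∈ J := by
    intro k k₀
    by_cases hk : k = k₀
    · subst hk; rw [sub_self]; exact J.zero_mem
    · have h := hJlie (single k k₀ (1 : K)) (trace_single_eq_of_ne k k₀ 1 hk) (hall (Ne.symm hk))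
      rwa [single_comm_single_transpose] at h
  -- Step 3: `J ⊇ 𝔰𝔩_n`, i.e. `I = ⊤`
  rw [eq_top_iff]
  rintro y -
  have hyJ : (y : Matrix n n K) ∈ J := by
    rw [eq_sum_units_of_trace_eq_zero i (X := (y : Matrix n n K)) y.2]
    refine J.sum_mem fun a _ => J.sum_mem fun b _ => J.smul_mem _ ?_
    split_ifs with hab
    · exact hdiag a i
    · exact hall hab
  obtain ⟨hy, hyI⟩ := hJmem.1 hyJ
  exact hyI

variable (n K) in
/-- **`𝔰𝔩(n, K)` IS SIMPLE** for `|n| ≥ 2` when `2 ≠ 0` and `|n| ≠ 0` in `K` (Mathlib `LieAlgebra.IsSimple`).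
[cite: Humphreys1972, §2 Exercise 6, §19.2] -/
theorem isSimple_sl (h2 : (2 : K) ≠ 0) (hn : (Fintype.card n : K) ≠ 0) (hcard : 1 < Fintype.card n) :
    LieAlgebra.IsSimple K (sl n K) :=
  ⟨eq_bot_or_eq_top_of_lieIdeal h2 hn, sl_non_abelian n K hcard⟩

variable (n K) in
/-- **`𝔰𝔩(n, K)` is simple in characteristic zero for `|n| ≥ 2`**. [cite: Humphreys1972, §19.2] -/
theorem isSimple_sl_of_charZero [CharZero K] (hcard : 1 < Fintype.card n) : LieAlgebra.IsSimple K (sl n K) :=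
  isSimple_sl n K two_ne_zero (Nat.cast_ne_zero.2 (by omega)) hcard

variable (n K) in
/-- Instance form: `𝔰𝔩(n, K)` is simple, given `[CharZero K]` and `[Fact (1 < Fintype.card n)]`.
[cite: Humphreys1972, §19.2] -/
instance instIsSimpleSl [CharZero K] [h : Fact (1 < Fintype.card n)] : LieAlgebra.IsSimple K (sl n K) :=
  isSimple_sl_of_charZero n K h.out

end Literature.Algebra.Lie.SpecialLinearSimple
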